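import Literature.NumberTheory.GaloisCohomology.Howard2004.KolyvaginSystemScalars
import Literature.LinearAlgebra.UnimodularCommutantScalar
import Mathlib.Algebra.Module.Torsion.Basic
import Mathlib.RingTheory.Henselian
import HarnessLib

/-!
# Howard 2004, Def. 1.1.8: two admissible finite–singular slots differ by a unit

Topic `NumberTheory/GaloisCohomology/Howard2004`; theorems only (no definition, no named fact, no
`sorry`).  Cell `pub/bsd-print-x9`, x9-p1 LEAD ruling 2026-08-28 «(n2)», first half: «natural +
bijective ⇒ `fs = u · φ^{fs}` with `u` a unit» (reading note (v) of lit's `FiniteSingularNatural`).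
The pure algebra is `Literature.LinearAlgebra.UnimodularCommutantScalar`
(`exists_units_apply_eq_map_smul_of_forall_intertwine`); this file threads it through the
cohomology at one pair `(m, λ)`:

* **`LevelData.exists_unit_fs_eq_sqSMul_of_natural`** — at `(m, λ)` with `Γ_{K_λ}` acting
  trivially on the presentation `N_m = T/I_mT` (Howard's standing at `λ ∈ m`: `T` unramified at
  `λ ∈ 𝓛₀`, `Frob_λ ≡ 1 mod I_ℓ ⊆ I_m`), `N_m` killed by an ideal `I` and possessing a unimodular
  pair over `R/I` (`x₀`, `φ : N_m → R/I` `R`-linear, `φ x₀ = 1` — from H.0: `T^{(k)}/I_m` is free of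
  rank two over `R_k/I_m`), and an EVALUATION `ev : H¹(K_λ, N_m) → N_m` bijective on the finite
  classes and natural along the locally equivariant `R`-linear endomorphisms (Prop. 1.1.7,
  evaluation at a Frobenius — (n1), lit's `evalClass`): if the slot `D.fs m λ` and a second slot
  `fs₂` are both natural along those endomorphisms and bijective on the finite classes (lit's (i) +
  (ii) at `(m, m, λ)`), then `fs₂ = (u•) ⊗ 1 ∘ D.fs m λ` on the finite classes for some `u ∈ R`
  whose class in `R/I` is a unit (`D.sqSMul hρ m λ u`, the relation `IsRescaledFs` consumes).
* `exists_mul_eq_one_of_isUnit_mk` — over a LOCAL coefficient ring with `I` proper the scalar is a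
  unit of `R` itself (`w u = 1`), the shape `KolyvaginSystemRescalingProofs` takes.

BSD is not proved by any of this.

References: B. Howard, *The Heegner point Kolyvagin system*, Compositio Math. 140 (2004), Prop.
1.1.7, Def. 1.1.8, H.0 (arXiv:1202.6340 p. 5 L115–131, p. 7 L57); N. Jacobson, *Lectures in Abstract
Algebra II*, Ch. III §18 Thm 20′.
-/

set_option autoImplicit false

noncomputable section

open Function NumberField IsDedekindDomain Field
open scoped NumberField ContRepresentation Classical TensorProduct

namespace Literature.NumberTheory.GaloisCohomology.Howard2004

open Literature.NumberTheory.GaloisRepresentations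
open Literature.NumberTheory.GaloisRepresentations.DiscreteGaloisModule
open Literature.NumberTheory.GaloisRepresentations.galoisCohomology

/-- Over a local ring a scalar whose class modulo a proper ideal is a unit is a unit: `∃ w, w u = 1`.
[cite: Howard2004HeegnerKolyvagin, §1 conventions (coefficient rings are local; arXiv p. 4, L47–52)] -/
theorem exists_mul_eq_one_of_isUnit_mk {R : Type} [CommRing R] [IsLocalRing R] {I : Ideal R}
    (hI : I ≠ ⊤) {u : R} (hu : IsUnit (Ideal.Quotient.mk I u)) : ∃ w : R, w * u = 1 := by
  haveI := isLocalHom_of_le_jacobson_bot I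
    ((IsLocalRing.le_maximalIdeal hI).trans (IsLocalRing.maximalIdeal_le_jacobson ⊥))
  obtain ⟨x, hx⟩ := (isUnit_map_iff (Ideal.Quotient.mk I) u).mp hu
  exact ⟨↑x⁻¹, by rw [← hx, Units.inv_mul]⟩

namespace LevelData

variable {K : Type} [Field K] [NumberField K] {M : Type} [AddCommGroup M] [TopologicalSpace M]
  [DiscreteTopology M] {R : Type} [CommRing R] [Module R M]
  {p : ℕ} [Fact p.Prime] {ρ : DiscreteGaloisModule K M} {t : SelmerTriple p ρ}
  {N : Finset (HeightOneSpectrum (𝓞 K)) → Type} [∀ n, AddCommGroup (N n)]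
  [∀ n, TopologicalSpace (N n)] [∀ n, DiscreteTopology (N n)] [∀ n, Module R (N n)]

omit [Fact p.Prime] in
/-- **Two admissible finite–singular slots differ by a unit scalar** (reading note (v) of
`FiniteSingularNatural`, first half, in the kernel).  See the module docstring for the hypotheses;
the conclusion is the relation `fs₂ = (u•) ⊗ 1 ∘ fs` on the finite classes of `H¹(K_λ, T/I_mT)`
with `u` a unit modulo `I`.  Proof: transport `fs, fs₂` along `ev` to maps `e, f : N_m → H¹_s ⊗ G_ℓ`;
naturality along the rank-one endomorphisms `y ↦ φ y • x` of `N_m` (locally equivariant because the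
local action is trivial) is exactly the intertwining hypothesis of
`exists_units_apply_eq_map_smul_of_forall_intertwine`; the resulting unit `ū ∈ (R/I)ˣ` is read back
through naturality along `u • id`.
[cite: Howard2004HeegnerKolyvagin, Prop. 1.1.7 and Def. 1.1.8 (arXiv p. 5, L115–131)] -/
theorem exists_unit_fs_eq_sqSMul_of_natural (D : LevelData R ρ t N) (hρ : ρ.IsScalarLinear R)
    {m : Finset (HeightOneSpectrum (𝓞 K))} {v : HeightOneSpectrum (𝓞 K)}
    (htriv : ∀ (σ : absoluteGaloisGroup (v.adicCompletion K)) (x : N m),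
      GaloisRep.toLocal v (D.ρq m) σ x = x)
    {I : Ideal R} (hI : Module.IsTorsionBySet R (N m) I)
    (x₀ : N m) (φ : N m →ₗ[R] R ⧸ I) (hφ : φ x₀ = 1)
    (ev : galoisCohomology (GaloisRep.toLocal v (D.ρq m)) 1 →+ N m)
    (hev : Function.Bijective fun c : unramifiedSubgroup (GaloisRep.toLocal v (D.ρq m)) 1 =>
      ev (c : galoisCohomology (GaloisRep.toLocal v (D.ρq m)) 1))
    (hev_nat : ∀ (g : N m →ₗ[R] N m)
      (hg : ∀ (σ : absoluteGaloisGroup (v.adicCompletion K)) (x : N m),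
        g.toAddMonoidHom (GaloisRep.toLocal v (D.ρq m) σ x) =
          GaloisRep.toLocal v (D.ρq m) σ (g.toAddMonoidHom x))
      (c : galoisCohomology (GaloisRep.toLocal v (D.ρq m)) 1),
      ev (localH1Map (D.ρq m) (D.ρq m) v g.toAddMonoidHom hg c) = g (ev c))
    (h1nat : D.FsNaturalAt m m v) (h1bij : D.FsBijectiveAt m v)
    (fs₂ : galoisCohomology ((D.ρq m).toLocal (Sum.inr v)) 1 →+
      SingularQuotient (GaloisRep.toLocal v (D.ρq m)) ⊗[ℤ] Gell v)
    (h2nat : ∀ (g : N m →ₗ[R] N m)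
      (hg : ∀ (σ : absoluteGaloisGroup (v.adicCompletion K)) (x : N m),
        g.toAddMonoidHom (GaloisRep.toLocal v (D.ρq m) σ x) =
          GaloisRep.toLocal v (D.ρq m) σ (g.toAddMonoidHom x)),
      ∀ c ∈ unramifiedSubgroup (GaloisRep.toLocal v (D.ρq m)) 1,
        fs₂ (localH1Map (D.ρq m) (D.ρq m) v g.toAddMonoidHom hg c) =
          TensorProduct.map (singularQuotientMap (D.ρq m) (D.ρq m) v g.toAddMonoidHom hg).toIntLinearMap
            LinearMap.id (fs₂ c))
    (h2bij : Function.Bijective fun c : unramifiedSubgroup (GaloisRep.toLocal v (D.ρq m)) 1 =>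
      fs₂ (c : galoisCohomology (GaloisRep.toLocal v (D.ρq m)) 1)) :
    ∃ u : R, IsUnit (Ideal.Quotient.mk I u) ∧
      ∀ c ∈ unramifiedSubgroup (GaloisRep.toLocal v (D.ρq m)) 1,
        fs₂ c = D.sqSMul hρ m v u (D.fs m v c) := by
  letI : Module (R ⧸ I) (N m) := hI.module
  -- notation
  set U := unramifiedSubgroup (GaloisRep.toLocal v (D.ρq m)) 1 with hU
  -- locally equivariant = everything, the local action being trivial
  have heqv : ∀ (g : N m →ₗ[R] N m) (σ : absoluteGaloisGroup (v.adicCompletion K)) (x : N m),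
      g.toAddMonoidHom (GaloisRep.toLocal v (D.ρq m) σ x) =
        GaloisRep.toLocal v (D.ρq m) σ (g.toAddMonoidHom x) := fun g σ x => by
    rw [htriv, htriv]
  -- the evaluation as an additive equivalence `U ≃+ N m`
  let evU : ↥U ≃+ N m := AddEquiv.ofBijective (ev.comp U.subtype) hev
  have hevU : ∀ c : ↥U, evU c = ev c := fun _ => rfl
  have hsymm : ∀ c : ↥U, evU.symm (ev c) = c := fun c => by
    rw [← hevU, AddEquiv.symm_apply_apply]
  -- `H¹(g)` read through `ev`: `ev⁻¹ (g y) = H¹(g) (ev⁻¹ y)`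
  have hnatU : ∀ (g : N m →ₗ[R] N m) (y : N m),
      evU.symm (g y) = ⟨localH1Map (D.ρq m) (D.ρq m) v g.toAddMonoidHom (heqv g) (evU.symm y),
        localH1Map_mem_unramifiedSubgroup _ _ v _ _ (evU.symm y).2⟩ := by
    intro g y
    have hy : y = ev (evU.symm y : ↥U) := by rw [← hevU, AddEquiv.apply_symm_apply]
    conv_lhs => rw [hy, ← hev_nat g (heqv g)]
    exact hsymm ⟨_, _⟩
  -- the two slots transported to `N m`
  let e₁ : N m →+ SingularQuotient (GaloisRep.toLocal v (D.ρq m)) ⊗[ℤ] Gell v :=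
    ((D.fs m v).comp U.subtype).comp evU.symm.toAddMonoidHom
  have he₁ : Function.Bijective e₁ := h1bij.comp evU.symm.bijective
  let e : N m ≃+ SingularQuotient (GaloisRep.toLocal v (D.ρq m)) ⊗[ℤ] Gell v :=
    AddEquiv.ofBijective e₁ he₁
  have he : ∀ y, e y = D.fs m v ((evU.symm y : ↥U) : galoisCohomology (GaloisRep.toLocal v (D.ρq m)) 1) :=
    fun _ => rfl
  let f : N m →+ SingularQuotient (GaloisRep.toLocal v (D.ρq m)) ⊗[ℤ] Gell v :=
    (fs₂.comp U.subtype).comp evU.symm.toAddMonoidHom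
  have hf : ∀ y, f y = fs₂ ((evU.symm y : ↥U) : galoisCohomology (GaloisRep.toLocal v (D.ρq m)) 1) :=
    fun _ => rfl
  have hfsurj : Function.Surjective f := (h2bij.comp evU.symm.bijective).2
  -- the unimodular form over `R ⧸ I`
  let φ' : N m →ₗ[R ⧸ I] R ⧸ I :=
    { toFun := φ
      map_add' := φ.map_add
      map_smul' := by
        intro q y
        obtain ⟨r, rfl⟩ := Ideal.Quotient.mk_surjective q
        change φ (r • y) = Ideal.Quotient.mk I r * φ y
        rw [map_smul, Algebra.smul_def, Ideal.Quotient.algebraMap_eq] }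
  have hφ' : φ' x₀ = 1 := hφ
  -- the rank-one endomorphisms `y ↦ φ y • x` as `R`-linear maps of `N m`
  let g₁ : N m → N m →ₗ[R] N m := fun x =>
    { toFun := fun y => φ' y • x
      map_add' := fun y z => by rw [map_add, add_smul]
      map_smul' := fun r y => by
        change φ' (Ideal.Quotient.mk I r • y) • x = r • (φ' y • x)
        rw [map_smul, smul_eq_mul, mul_smul]
        rfl }
  have hg₁ : ∀ x y, g₁ x y = φ' y • x := fun _ _ => rfl
  -- the intertwining hypothesis
  have hinter : ∀ x : N m, ∃ G : SingularQuotient (GaloisRep.toLocal v (D.ρq m)) ⊗[ℤ] Gell v →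
      SingularQuotient (GaloisRep.toLocal v (D.ρq m)) ⊗[ℤ] Gell v,
      (∀ y, e (φ' y • x) = G (e y)) ∧ ∀ y, f (φ' y • x) = G (f y) := by
    intro x
    refine ⟨TensorProduct.map (singularQuotientMap (D.ρq m) (D.ρq m) v (g₁ x).toAddMonoidHom
      (heqv (g₁ x))).toIntLinearMap LinearMap.id, fun y => ?_, fun y => ?_⟩
    · rw [he, he, ← hg₁, hnatU]
      exact h1nat (g₁ x) (heqv (g₁ x)) _ (evU.symm y).2
    · rw [hf, hf, ← hg₁, hnatU]
      exact h2nat (g₁ x) (heqv (g₁ x)) _ (evU.symm y).2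
  obtain ⟨ubar, hubar⟩ :=
    Literature.LinearAlgebra.exists_units_apply_eq_map_smul_of_forall_intertwine e f hφ' hinter hfsurj
  obtain ⟨u, hu⟩ := Ideal.Quotient.mk_surjective (ubar : R ⧸ I)
  refine ⟨u, hu ▸ ubar.isUnit, fun c hc => ?_⟩
  -- read the unit back through `ev` and naturality along `u • id`
  have h1 : fs₂ c = f (ev c) := by rw [hf, hsymm ⟨c, hc⟩]
  have h2 : (ubar : R ⧸ I) • ev c = (u • LinearMap.id : N m →ₗ[R] N m) (ev c) := by
    rw [← hu]; rfl
  rw [h1, hubar, he, h2, hnatU, hsymm ⟨c, hc⟩, sqSMul_def]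
  exact h1nat (u • LinearMap.id) (heqv _) c hc

end LevelData

end Literature.NumberTheory.GaloisCohomology.Howard2004

end
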